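import Summits.ValiantsHypothesis.ValiantsHypothesis.Theorems.LacunarySymmetroidMatrixDescartesPivotRankOneFourKillSeven

/-!
# `MatrixDescartes` census — rank-one `(2,4)₁` in chamber (B): `Z₊ ≤ 8` under the INNER-PAIRS condition (P′)
# (kept degrees `d₀+d₂, d₁+d₂, d₀+d₃, d₁+d₃`; weight-free and `J`-free; the set that closes the located coverage of chamber (B))

HONEST FRAMING.  Object-search cell `pub-symmetroid`, seat `val-sym-mdr-p1` (generation 14); helper file `--supports` the crux item
stmt-ValiantsHypothesis-18050 (`Theses.LacunarySymmetroid.MatrixDescartes`, OPEN, on HOLD) with NO closure claim.  A fifth weight-free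
kill-seven theorem for the rank-one `(2,4)₁` cell in the interleaving chamber (B) of the split `d₀ < d₁ < e < d₂ < d₃` (companions:
(S) `…PivotRankOneFourKillSeven`, (S′) `…Prime`, (P) `…Pairs`, (T) `…Bottom`; weight-dependent family (C₀)…(C₃), (C_J):
`…PivotRankOneFourKillEight{,Top}`).  Kept set = the four INNER cross pairs `{d₀+d₂, d₁+d₂, d₀+d₃, d₁+d₃} = {d₂, d₃} + {d₀, d₁}`
(grid steps `d₁ − d₀` and `d₃ − d₂`); killing `2e, e+d₀, …, e+d₃, d₀+d₁, d₂+d₃` leaves MINUS the four-nomial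
`A X^{d₀+d₂} − B X^{d₁+d₂} + C X^{d₀+d₃} − D X^{d₁+d₃}` with `B = w₁w₂Δ₁₂²·Π_B > 0`, `D = w₁w₃Δ₁₃²·Π_D > 0`, and the cross-ratio
hypothesis of the four-nomial lemma is **(P′) `Δ₁₂²·Δ₀₃²·Π_BΠ_C ≤ Δ₀₂²·Δ₁₃²·Π_AΠ_D`** — direction-only (all weights AND the pivot
cancel); in `t`-coordinates `σ₁₂σ₀₃·Π_BΠ_C ≤ σ₀₂σ₁₃·Π_AΠ_D` (hyperbolic chords `σₖₗ = (tₖ−tₗ)²/(tₖtₗ)`).  Exponent hypotheses: only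
`d₁+d₂ < 2e < d₀+d₃` and `e+d₂ < d₁+d₃` (for the signs of the `B`, `D` survivors); `J`, `m₀…m₃`, `Δ₀₁`, `Δ₂₃` arbitrary.
Theorems: `elevenNomial_chamberB_Pprime_le_eight` (real-parameter form), `rankOne_posRoots_le_eight_of_condPprime` (matrix form).

WHY THIS SET (located, seat exp/cover14.py + corner_which.py, hub floats, pure python ≤ 110 s): over 2·10⁵ adversarial samples of
chamber (B) × directions × WEIGHTS (faces at 10⁻⁶, clustered / staircase / extreme directions, weights over 30 decades, and a dense
sweep of generation 13's uncovered corner `(a,a′,b,b′) = (1, 0.3, 0.3−ε, 1.15)`, `t = (t₀ ≪ 1, 1, T, T e^{δ})`), the kernel sets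
(S), (S′), (P), (T) together with the five circuit triples leave ≈ 0.2 % uncovered (all with `Z₊ ≤ 4`), and EVERY ONE of those is
covered by (P′); with (P′) added no uncovered sample was met.  So the ten kernel theorems {S, S′, P, T, P′} ∪ {C₀, C₁, C_J, C₂, C₃}
located-cover the rank-one chamber-(B) cell — a COVERING THEOREM (real-algebraic case analysis on the 9-dimensional configuration
space) is what remains; it is NOT claimed here.  Nothing in this file bears on `MatrixDescartes` in its window, on `DoorA26` / `DoorA34`,
registers / credences, or `VP ≠ VNP`.

[folklore] The engine of `…PivotTwoDirectionsBlockLaw` (weighted Rolle + four-nomial lemma); `2 × 2` determinant algebra.  No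
definitions, no named facts.
-/

-- `Summit.ValiantsHypothesis.ValiantsHypothesis.…` repeats a component by the D-0017 layout
-- (single-conjunct summit), which the `dupNamespace` linter flags; the name is mandated.
set_option linter.dupNamespace false

namespace Summit.ValiantsHypothesis.ValiantsHypothesis.Theorems.LacunarySymmetroidMatrixDescartes.Pivot.TwoDirections.BlockLaw

open Polynomial Matrix Finset
open scoped BigOperators

/-- **(P′), real-parameter form.**  The eleven-nomial of the split `d₀ < d₁ < e < d₂ < d₃` with `d₁+d₂ < 2e < d₀+d₃`, `e+d₂ < d₁+d₃`
(`w₀,…,w₃ > 0`, `D12, D13 > 0`; `dJ`, the pairings `mₖ` and `D01, D02, D03, D23` arbitrary) has at most EIGHT positive roots under the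
inner-pairs condition (P′) (kept degrees `d₀+d₂, d₁+d₂, d₀+d₃, d₁+d₃`). -/
theorem elevenNomial_chamberB_Pprime_le_eight (e d₀ d₁ d₂ d₃ : ℕ) (h01 : d₀ < d₁) (h1e : d₁ < e) (he2 : e < d₂) (h23 : d₂ < d₃)
    (hB2 : d₁ + d₂ < 2 * e) (hB3 : 2 * e < d₀ + d₃) (hB5 : e + d₂ < d₁ + d₃)
    (dJ m₀ m₁ m₂ m₃ w₀ w₁ w₂ w₃ D01 D02 D03 D12 D13 D23 : ℝ) (hw₀ : 0 < w₀) (hw₁ : 0 < w₁) (hw₂ : 0 < w₂) (hw₃ : 0 < w₃) (hD12 : 0 < D12) (hD13 : 0 < D13)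
    (hS : D12 * D03
        * (((2 : ℝ) * e - d₁ - d₂) * ((d₁ : ℝ) + d₂ - e - d₀) * ((d₂ : ℝ) - e) * ((e : ℝ) - d₁) * ((e : ℝ) + d₃ - d₁ - d₂) * ((d₂ : ℝ) - d₀) * ((d₃ : ℝ) - d₁))
        * (((d₀ : ℝ) + d₃ - 2 * e) * ((d₃ : ℝ) - e) * ((d₀ : ℝ) + d₃ - e - d₁) * ((e : ℝ) + d₂ - d₀ - d₃) * ((e : ℝ) - d₀) * ((d₃ : ℝ) - d₁) * ((d₂ : ℝ) - d₀))
        ≤ D02 * D13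
        * (((2 : ℝ) * e - d₀ - d₂) * ((d₂ : ℝ) - e) * ((e : ℝ) + d₁ - d₀ - d₂) * ((e : ℝ) - d₀) * ((e : ℝ) + d₃ - d₀ - d₂) * ((d₂ : ℝ) - d₁) * ((d₃ : ℝ) - d₀))
        * (((d₁ : ℝ) + d₃ - 2 * e) * ((d₁ : ℝ) + d₃ - e - d₀) * ((d₃ : ℝ) - e) * ((d₁ : ℝ) + d₃ - e - d₂) * ((e : ℝ) - d₁) * ((d₃ : ℝ) - d₀) * ((d₂ : ℝ) - d₁))) :
    ((∑ i : Fin 11, Polynomial.C ((![dJ, w₀ * m₀, w₁ * m₁, w₂ * m₂, w₃ * m₃, w₀ * w₁ * D01, w₀ * w₂ * D02, w₀ * w₃ * D03, w₁ * w₂ * D12, w₁ * w₃ * D13, w₂ * w₃ * D23] : Fin 11 → ℝ) i) * X ^ ((![2 * e, e + d₀, e + d₁, e + d₂, e + d₃, d₀ + d₁, d₀ + d₂, d₀ + d₃, d₁ + d₂, d₁ + d₃, d₂ + d₃] : Fin 11 → ℕ) i)).roots.toFinset.filter (fun t => 0 < t)).card ≤ 8 := by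
  classical
  have h01' : (d₀ : ℝ) < d₁ := by exact_mod_cast h01
  have h1e' : (d₁ : ℝ) < e := by exact_mod_cast h1e
  have he2' : (e : ℝ) < d₂ := by exact_mod_cast he2
  have h23' : (d₂ : ℝ) < d₃ := by exact_mod_cast h23
  have hB2' : (d₁ : ℝ) + d₂ < 2 * e := by exact_mod_cast hB2
  have hB3' : 2 * (e : ℝ) < d₀ + d₃ := by exact_mod_cast hB3
  have hB5' : (e : ℝ) + d₂ < d₁ + d₃ := by exact_mod_cast hB5
  -- the four distance products (positive atoms)
  obtain ⟨PA, hPA⟩ : ∃ x : ℝ, x = ((2 : ℝ) * e - d₀ - d₂) * ((d₂ : ℝ) - e) * ((e : ℝ) + d₁ - d₀ - d₂) * ((e : ℝ) - d₀) * ((e : ℝ) + d₃ - d₀ - d₂) * ((d₂ : ℝ) - d₁) * ((d₃ : ℝ) - d₀) := ⟨_, rfl⟩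
  obtain ⟨PB, hPB⟩ : ∃ x : ℝ, x = ((2 : ℝ) * e - d₁ - d₂) * ((d₁ : ℝ) + d₂ - e - d₀) * ((d₂ : ℝ) - e) * ((e : ℝ) - d₁) * ((e : ℝ) + d₃ - d₁ - d₂) * ((d₂ : ℝ) - d₀) * ((d₃ : ℝ) - d₁) := ⟨_, rfl⟩
  obtain ⟨PC, hPC⟩ : ∃ x : ℝ, x = ((d₀ : ℝ) + d₃ - 2 * e) * ((d₃ : ℝ) - e) * ((d₀ : ℝ) + d₃ - e - d₁) * ((e : ℝ) + d₂ - d₀ - d₃) * ((e : ℝ) - d₀) * ((d₃ : ℝ) - d₁) * ((d₂ : ℝ) - d₀) := ⟨_, rfl⟩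
  obtain ⟨PD, hPD⟩ : ∃ x : ℝ, x = ((d₁ : ℝ) + d₃ - 2 * e) * ((d₁ : ℝ) + d₃ - e - d₀) * ((d₃ : ℝ) - e) * ((d₁ : ℝ) + d₃ - e - d₂) * ((e : ℝ) - d₁) * ((d₃ : ℝ) - d₀) * ((d₂ : ℝ) - d₁) := ⟨_, rfl⟩
  have hS' : D12 * D03 * PB * PC ≤ D02 * D13 * PA * PD := by rw [hPA, hPB, hPC, hPD]; exact hS
  clear hS
  have hPBp : 0 < PB := by
    rw [hPB]
    have f1 : 0 < ((2 : ℝ) * e - d₁ - d₂) := by linarith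
    have f2 : 0 < ((d₁ : ℝ) + d₂ - e - d₀) := by linarith
    have f3 : 0 < ((d₂ : ℝ) - e) := by linarith
    have f4 : 0 < ((e : ℝ) - d₁) := by linarith
    have f5 : 0 < ((e : ℝ) + d₃ - d₁ - d₂) := by linarith
    have f6 : 0 < ((d₂ : ℝ) - d₀) := by linarith
    have f7 : 0 < ((d₃ : ℝ) - d₁) := by linarith
    exact mul_pos (mul_pos (mul_pos (mul_pos (mul_pos (mul_pos f1 f2) f3) f4) f5) f6) f7
  have hPDp : 0 < PD := by
    rw [hPD]
    have f1 : 0 < ((d₁ : ℝ) + d₃ - 2 * e) := by linarith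
    have f2 : 0 < ((d₁ : ℝ) + d₃ - e - d₀) := by linarith
    have f3 : 0 < ((d₃ : ℝ) - e) := by linarith
    have f4 : 0 < ((d₁ : ℝ) + d₃ - e - d₂) := by linarith
    have f5 : 0 < ((e : ℝ) - d₁) := by linarith
    have f6 : 0 < ((d₃ : ℝ) - d₀) := by linarith
    have f7 : 0 < ((d₂ : ℝ) - d₁) := by linarith
    exact mul_pos (mul_pos (mul_pos (mul_pos (mul_pos (mul_pos f1 f2) f3) f4) f5) f6) f7
  -- the four surviving coefficients
  obtain ⟨A, hA⟩ : ∃ x : ℝ, x = w₀ * w₂ * D02 * PA := ⟨_, rfl⟩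
  obtain ⟨B, hB⟩ : ∃ x : ℝ, x = w₁ * w₂ * D12 * PB := ⟨_, rfl⟩
  obtain ⟨C, hC⟩ : ∃ x : ℝ, x = w₀ * w₃ * D03 * PC := ⟨_, rfl⟩
  obtain ⟨D, hD⟩ : ∃ x : ℝ, x = w₁ * w₃ * D13 * PD := ⟨_, rfl⟩
  have hBp : 0 < B := by rw [hB]; exact mul_pos (mul_pos (mul_pos hw₁ hw₂) hD12) hPBp
  have hDp : 0 < D := by rw [hD]; exact mul_pos (mul_pos (mul_pos hw₁ hw₃) hD13) hPDp
  have hBC : B * C ≤ A * D := by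
    have e1 : B * C = (w₀ * w₁ * w₂ * w₃) * (D12 * D03 * PB * PC) := by rw [hB, hC]; ring
    have e2 : A * D = (w₀ * w₁ * w₂ * w₃) * (D02 * D13 * PA * PD) := by rw [hA, hD]; ring
    rw [e1, e2]
    exact mul_le_mul_of_nonneg_left hS' (mul_pos (mul_pos (mul_pos hw₀ hw₁) hw₂) hw₃).le
  -- seven kills
  have hkills := card_posRoots_le_kills (Finset.univ : Finset (Fin 11)) (![2 * e, e + d₀, e + d₁, e + d₂, e + d₃, d₀ + d₁, d₀ + d₂, d₀ + d₃, d₁ + d₂, d₁ + d₃, d₂ + d₃] : Fin 11 → ℕ) [2 * e, e + d₀, e + d₁, e + d₂, e + d₃, d₀ + d₁, d₂ + d₃] (![dJ, w₀ * m₀, w₁ * m₁, w₂ * m₂, w₃ * m₃, w₀ * w₁ * D01, w₀ * w₂ * D02, w₀ * w₃ * D03, w₁ * w₂ * D12, w₁ * w₃ * D13, w₂ * w₃ * D23] : Fin 11 → ℝ)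
  have hfour : (∑ i ∈ (Finset.univ : Finset (Fin 11)), Polynomial.C ((![dJ, w₀ * m₀, w₁ * m₁, w₂ * m₂, w₃ * m₃, w₀ * w₁ * D01, w₀ * w₂ * D02, w₀ * w₃ * D03, w₁ * w₂ * D12, w₁ * w₃ * D13, w₂ * w₃ * D23] : Fin 11 → ℝ) i
          * (([2 * e, e + d₀, e + d₁, e + d₂, e + d₃, d₀ + d₁, d₂ + d₃]).map (fun ρ : ℕ => (((((![2 * e, e + d₀, e + d₁, e + d₂, e + d₃, d₀ + d₁, d₀ + d₂, d₀ + d₃, d₁ + d₂, d₁ + d₃, d₂ + d₃] : Fin 11 → ℕ)) i : ℕ) : ℝ) - (ρ : ℝ)))).prod) * X ^ ((![2 * e, e + d₀, e + d₁, e + d₂, e + d₃, d₀ + d₁, d₀ + d₂, d₀ + d₃, d₁ + d₂, d₁ + d₃, d₂ + d₃] : Fin 11 → ℕ) i))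
      = -(Polynomial.C A * X ^ (d₀ + d₂) - Polynomial.C B * X ^ (d₀ + d₂ + (d₁ - d₀))
          + Polynomial.C C * X ^ (d₀ + d₂ + (d₃ - d₂)) - Polynomial.C D * X ^ (d₀ + d₂ + (d₁ - d₀) + (d₃ - d₂))) := by
    have e3 : d₀ + d₂ + (d₁ - d₀) + (d₃ - d₂) = d₁ + d₃ := by omega
    have e1 : d₀ + d₂ + (d₁ - d₀) = d₁ + d₂ := by omega
    have e2 : d₀ + d₂ + (d₃ - d₂) = d₀ + d₃ := by omega
    rw [e3, e1, e2]
    have hcoef : ∀ i : Fin 11, (![dJ, w₀ * m₀, w₁ * m₁, w₂ * m₂, w₃ * m₃, w₀ * w₁ * D01, w₀ * w₂ * D02, w₀ * w₃ * D03, w₁ * w₂ * D12, w₁ * w₃ * D13, w₂ * w₃ * D23] : Fin 11 → ℝ) i * (([2 * e, e + d₀, e + d₁, e + d₂, e + d₃, d₀ + d₁, d₂ + d₃]).map (fun ρ : ℕ => (((((![2 * e, e + d₀, e + d₁, e + d₂, e + d₃, d₀ + d₁, d₀ + d₂, d₀ + d₃, d₁ + d₂, d₁ + d₃, d₂ + d₃]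 : Fin 11 → ℕ)) i : ℕ) : ℝ) - (ρ : ℝ)))).prod
        = (![0, 0, 0, 0, 0, 0, -A, -C, B, D, 0] : Fin 11 → ℝ) i := by
      intro i
      fin_cases i <;>
        simp only [Fin.zero_eta, Fin.mk_one, Fin.isValue, Matrix.cons_val_zero, Matrix.cons_val_one,
          List.map_cons, List.map_nil, List.prod_cons, List.prod_nil, hA, hB, hC, hD, hPA, hPB, hPC, hPD] <;>
        push_cast <;> ring
    rw [Finset.sum_congr rfl (fun i _ => by rw [hcoef i])]
    simp only [Fin.sum_univ_succ, Fin.sum_univ_zero, Matrix.cons_val_zero, Matrix.cons_val_succ, map_zero, zero_mul,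
      zero_add, add_zero, Polynomial.C_neg]
    ring
  rw [hfour, Polynomial.roots_neg] at hkills
  have hone := card_posRoots_fourNomial_le_one A B C D hBp hDp hBC (d₀ + d₂) (d₁ - d₀) (d₃ - d₂) (by omega)
  simp only [List.length_cons, List.length_nil] at hkills
  omega

/-- **RANK-ONE `(2,4)₁` IN CHAMBER (B): `Z₊ ≤ 8` under (P′)** (matrix form; `J` arbitrary, all weights positive, letters `1,2` and
`1,3` not parallel; (P′) compares the chords `Δ₁₂²Δ₀₃²` against `Δ₀₂²Δ₁₃²` with exponent constants). [this file] -/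
theorem rankOne_posRoots_le_eight_of_condPprime (e d₀ d₁ d₂ d₃ : ℕ) (h01 : d₀ < d₁) (h1e : d₁ < e) (he2 : e < d₂) (h23 : d₂ < d₃)
    (hB2 : d₁ + d₂ < 2 * e) (hB3 : 2 * e < d₀ + d₃) (hB5 : e + d₂ < d₁ + d₃)
    (J : Matrix (Fin 2) (Fin 2) ℝ) (v₀ v₁ v₂ v₃ : Fin 2 → ℝ) (w₀ w₁ w₂ w₃ : ℝ) (hw₀ : 0 < w₀) (hw₁ : 0 < w₁) (hw₂ : 0 < w₂) (hw₃ : 0 < w₃)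
    (hv12 : v₁ 0 * v₂ 1 - v₁ 1 * v₂ 0 ≠ 0) (hv13 : v₁ 0 * v₃ 1 - v₁ 1 * v₃ 0 ≠ 0)
    (hS : ((v₁ 0 * v₂ 1 - v₁ 1 * v₂ 0) ^ 2) * ((v₀ 0 * v₃ 1 - v₀ 1 * v₃ 0) ^ 2)
        * (((2 : ℝ) * e - d₁ - d₂) * ((d₁ : ℝ) + d₂ - e - d₀) * ((d₂ : ℝ) - e) * ((e : ℝ) - d₁) * ((e : ℝ) + d₃ - d₁ - d₂) * ((d₂ : ℝ) - d₀) * ((d₃ : ℝ) - d₁))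
        * (((d₀ : ℝ) + d₃ - 2 * e) * ((d₃ : ℝ) - e) * ((d₀ : ℝ) + d₃ - e - d₁) * ((e : ℝ) + d₂ - d₀ - d₃) * ((e : ℝ) - d₀) * ((d₃ : ℝ) - d₁) * ((d₂ : ℝ) - d₀))
        ≤ ((v₀ 0 * v₂ 1 - v₀ 1 * v₂ 0) ^ 2) * ((v₁ 0 * v₃ 1 - v₁ 1 * v₃ 0) ^ 2)
        * (((2 : ℝ) * e - d₀ - d₂) * ((d₂ : ℝ) - e) * ((e : ℝ) + d₁ - d₀ - d₂) * ((e : ℝ) - d₀) * ((e : ℝ) + d₃ - d₀ - d₂) * ((d₂ : ℝ) - d₁) * ((d₃ : ℝ) - d₀))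
        * (((d₁ : ℝ) + d₃ - 2 * e) * ((d₁ : ℝ) + d₃ - e - d₀) * ((d₃ : ℝ) - e) * ((d₁ : ℝ) + d₃ - e - d₂) * ((e : ℝ) - d₁) * ((d₃ : ℝ) - d₀) * ((d₂ : ℝ) - d₁))) :
    ((Matrix.det (((X : ℝ[X]) ^ e) • J.map Polynomial.C
        + (Polynomial.C w₀ * X ^ d₀) • (vecMulVec v₀ v₀).map Polynomial.C
        + (Polynomial.C w₁ * X ^ d₁) • (vecMulVec v₁ v₁).map Polynomial.C
        + (Polynomial.C w₂ * X ^ d₂) • (vecMulVec v₂ v₂).map Polynomial.C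
        + (Polynomial.C w₃ * X ^ d₃) • (vecMulVec v₃ v₃).map Polynomial.C)).roots.toFinset.filter (fun t => 0 < t)).card
      ≤ 8 := by
  rw [det_rankOne_four_sum]
  exact elevenNomial_chamberB_Pprime_le_eight e d₀ d₁ d₂ d₃ h01 h1e he2 h23 hB2 hB3 hB5 J.det _ _ _ _ w₀ w₁ w₂ w₃ _ _ _ _ _ _
    hw₀ hw₁ hw₂ hw₃ (by positivity) (by positivity) hS

end Summit.ValiantsHypothesis.ValiantsHypothesis.Theorems.LacunarySymmetroidMatrixDescartes.Pivot.TwoDirections.BlockLaw
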